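import Summits.CriticalPhenomena.PercolationContinuityZ3.Theorems.Transplant.SkelFrmFrom1ReachHoldsQ3V
import Summits.CriticalPhenomena.PercolationContinuityZ3.Theorems.Transplant.SkelFrmFrom1ReachRadQVPxK
import Summits.CriticalPhenomena.PercolationContinuityZ3.Theorems.Transplant.SkelFrmFrom1ReachRadQUVPxK
import Summits.CriticalPhenomena.PercolationContinuityZ3.Theorems.Transplant.SkelFrmFromBChoiceHXVPx
import Summits.CriticalPhenomena.PercolationContinuityZ3.Theorems.Transplant.SkelFrmFromBChoiceHYVPx
import Summits.CriticalPhenomena.PercolationContinuityZ3.Theorems.Transplant.SkelFrmFromBChoiceSlotsPx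
import Summits.CriticalPhenomena.PercolationContinuityZ3.Theorems.Transplant.SkelFrmFromBParamsKitBump
import Summits.CriticalPhenomena.PercolationContinuityZ3.Theorems.Transplant.SkelFrmFrom1ChoiceDefsPx
import HarnessLib

/-!
# GEN ROW (RULING D-Us V147b / Us-R1–R6 lead g22; WAVE-Us-MANIFEST v1.0 §5 — THE (C) COLUMN TOP, slot-robust form) «SkelFrmFrom1ReachHoldsQ3VPx» — the GENERALISED
# twin of «SkelFrmFrom1ReachHoldsQ3V»'s `reachHoldsRHNQFnLK_frmChoiceAllQ3V_of_le`: **the budgeted corridor obligation `ReachHoldsRHNQFnLKPxAt LfQ Kmin` of the GEN choice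
# function of record at proxy radius `D`, for every box / width / pair / fibre slot dominating the (C) floors AT THE RAISED KIT INDEX `KS.RK t Dr 0 + D`** (cells = the
# tuple's `cvPx D` / `hvPx D`, arrival box `BSlot.small3`); the (C) NODE row «…ReachHoldsQ3VNodePx» instantiates it at `gvPx/fvPx/PvPx/exPx/mxPx` («…SlotsPx» p473802)

builds on p205010 (kernel theorem, internal audit signed; external expert review pending) — nothing in this file uses p205010; NOTHING about the OPEN node U_s
(`SamePDropOfSkeletonFrmScaled₁`) is claimed; no statement, no `@[conjecture]`, def-free.  Lane `prim-bschramm`, seat `prim-bschramm-gen-1` g0 (GEN pen, (C) column per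
RULING Us-R3); helper file (`--supports stmt-CriticalPhenomena-4575 --as helper`).
THE K-2 ASSEMBLY (design of record for the tops, C-TOP #5636 / TUPLE Px OF RECORD #5662): at every `(κ, Φ, t, p, O, q)` with `AtQNQ` of the Px choice data, the kit AND the
corridor are read at the Step-I record `O.merged` at the RAISED INDEX `mkP := KS.RK t O.merged 0 + D` (`NegB.RK_add_le_RK_raise_of_atQ`: `RK 0 + D ≤ RK mkP`), so that
hp-8's row bundles serve VERBATIM at `mkP` — «…HXVPx».`HX_QVAtPx` / «…HYVPx».`HY_QVAtPx` (pointwise floors, long radius `RL + D`) — and feed gen-1's K-2 rows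
«SkelFrmFrom1ReachRadQVPxK».`reachOblAtHNF_frmQ3VR_fstPxK` / «…RadQUVPxK».`reachOblAtHNF_frmQ3VR_sndUPxK` at `(Dk, mkP) := (O.merged, mkP)`, glued by
`Skel.reachOblRHNOF_of_axes` exactly as in U.  The cells: the tuple's `cvPx D` / `hvPx D` read `cR2W`/`hFR` at `KS.RK t Dr 0 + D` of the record they are evaluated at
(«SlotsPx» `raiseC`), so at `O.merged` they ARE `cR2W mkP` / `hFR mkP` — `AtQNQ` does not read cells (§1 `atQ3V_cells` / `atQ3VPx_cells`), and the scheme / face data of the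
cell readings of the bundles (`fcellsV … (cOf … (cR2W mkP)) (hOf … (hFR mkP))`) are rewritten into the tuple's cells by the two value equalities `cOf … (cvPx D) = cOf … (cR2W mkP)`,
`hOf … (hvPx D) = hOf … (hFR mkP)` («SlotsPx» `cvPx_at`/`hvPx_at`, `funext`) — no structure is unfolded.  Floors (the (C) SLOT LEDGER #5650): `Hg` (gFloorKG, 40·K·R′0 at the raised index), `Hex`/`HexY` (kit threshold at `RLD + D`, `ZD2 + 4`, `ZDYW + 4`).
[cite: KozmaNitzan2024, §4 Lemma 12 (pp. 23–25), p. 30 (Step IV)] [cite: BenjaminiSchramm1996, Conj. 4] [this work]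
-/

open scoped Classical

noncomputable section

namespace Summit.CriticalPhenomena.PercolationContinuityZ3.Theorems.Transplant

namespace PlanarSkeletonFrmFrom

open Literature.Probability.Percolation Literature.Probability.LatticeModels SimpleGraph GadgetSystem ProbeHistory HSiteScheme Contour KNCells
open KNCells.KSchA KNLevels
open Literature.Barriers.CriticalPhenomena (HasExponentialGrowth graphBall)
open Skel (ReachOblAtHNF excess)
open SkelConc (Consts)
open Skelφ.StepI (DataN DataNS OutNS)

/-! ## §1 `AtQNQ` does not read the fibre / creep / room / arrival slots -/

namespace NegB

open Neg

variable {κ : Consts} {V : Type} [DecidableEq V] [Countable V] {G : SimpleGraph V} [G.LocallyFinite] {Φ : PlanarSkeletonFrmFrom G} {t : V} {p : unitInterval}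
  {hC : Φ.CylSubcritical p} {gv fv : Neg.FSlot} {Pv : PSlot} {Sv Sv' : SSlot} {cv cv' hv hv' : CSlot} {bv bv' : BSlot} {O : OutNS V} {q : unitInterval}

/-- `AtQNQ` of the V choice data reads only `m₀`, `Sz`, `SMn`, `δI` (slots `Pv`, `gv`, `fv`): the fibre / creep / room / arrival slots are free. [folklore] -/
theorem atQ3V_cells (h : (choiceAtQ3V κ Φ t p Pv gv fv Sv cv hv bv hC).AtQNQ O q) : (choiceAtQ3V κ Φ t p Pv gv fv Sv' cv' hv' bv' hC).AtQNQ O q :=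
  ⟨h.1, h.2.1, h.2.2.1, h.2.2.2.1, h.2.2.2.2⟩

/-- The same for the Px choice data at radius `D`. [folklore] -/
theorem atQ3VPx_cells {D : ℕ} (h : (choiceAtQ3VPx κ Φ t p D Pv gv fv Sv cv hv bv hC).AtQNQ O q) : (choiceAtQ3VPx κ Φ t p D Pv gv fv Sv' cv' hv' bv' hC).AtQNQ O q :=
  ⟨h.1, h.2.1, h.2.2.1, h.2.2.2.1, h.2.2.2.2⟩

end NegB

/-! ## §2 The (C) column target under proxies, slot-robust form -/

/-- **THE (C) COLUMN TARGET OF RECORD UNDER PROXIES, SLOT-ROBUST FORM**: for every proxy radius `D`, every slot tuple whose box slot dominates `gFloorKG`/`40·K·R′0` and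
whose excess slot dominates the kit threshold at the long radius `RLD + D` and the x- and y-depth floors — ALL AT THE RAISED KIT INDEX `KS.RK t Dr 0 + D` of the record they
are read at — and every `Kmin ≥ 160`, the GEN choice function of record `frmChoiceAllQ3VPx D gv fv Pv (SUS ex mx) (cvPx D) (hvPx D) BSlot.small3` meets the budgeted
corridor obligation `ReachHoldsRHNQFnLKPxAt NegB.LfQ Kmin`.  (U's `reachHoldsRHNQFnLK_frmChoiceAllQ3V_of_le` read at `mkP`: `HX_QVAtPx`/`HY_QVAtPx` ∘ the K-2 rows ∘
`Skel.reachOblRHNOF_of_axes`.) [cite: KozmaNitzan2024, §4 Lemma 12, p. 30] -/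
theorem reachHoldsRHNQFnLKPxAt_frmChoiceAllQ3VPx_of_le (D Kmin : ℕ) (hKmin : 160 ≤ Kmin) {gv fv : Neg.FSlot} {Pv : NegB.PSlot} {ex mx : NegB.GSlot}
    (Hg : ∀ (κ : Consts) {V : Type} [DecidableEq V] [Countable V] {G : SimpleGraph V} [G.LocallyFinite] (Φ : PlanarSkeletonFrmFrom G) (t : V) (p : unitInterval)
      (Dr : DataNS V), NegB.gFloorKG κ Φ t p Dr (NegB.KS.RK t Dr 0 + D) ≤ gv κ Φ t p Dr ∧ 40 * Neg.K κ * NegB.KS0.R'0 κ Φ t p Dr (NegB.KS.RK t Dr 0 + D) ≤ gv κ Φ t p Dr)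
    (Hex : ∀ (κ : Consts) {V : Type} [DecidableEq V] [Countable V] {G : SimpleGraph V} [G.LocallyFinite] (Φ : PlanarSkeletonFrmFrom G) (t : V) (p : unitInterval)
      (Dr : DataNS V) (g f : ℕ), NegB.KS0.r₀0 t Dr (NegB.KS.RK t Dr 0 + D) (NegB.RLD κ Φ t p Dr g f + D) + 3 ≤ ex κ Φ t p Dr g f ∧ NegB.ZD2 κ Φ t p Dr g f + 4 ≤ ex κ Φ t p Dr g f)
    (HexY : ∀ (κ : Consts) {V : Type} [DecidableEq V] [Countable V] {G : SimpleGraph V} [G.LocallyFinite] (Φ : PlanarSkeletonFrmFrom G) (t : V) (p : unitInterval)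
      (Dr : DataNS V) (g f : ℕ), NegB.KS0.r₀0 t Dr (NegB.KS.RK t Dr 0 + D) (NegB.RLD κ Φ t p Dr g f + D) + 3 ≤ ex κ Φ t p Dr g f ∧ NegB.ZDYW κ Φ t p Dr g f + 4 ≤ ex κ Φ t p Dr g f) :
    ReachHoldsRHNQFnLKPxAt NegB.LfQ Kmin (frmChoiceAllQ3VPx D gv fv Pv (NegB.SUS ex mx) (NegB.cvPx D) (NegB.hvPx D) NegB.BSlot.small3) :=
  fun κ _ _ _ _ _ Φ _ t _ hP p hp0 hp1 hC hK => by
  show (NegB.choiceAtQ3VPx κ Φ t p D Pv gv fv (NegB.SUS ex mx) (NegB.cvPx D) (NegB.hvPx D) NegB.BSlot.small3 hC).ReachHoldsRHNQL NegB.LfQ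
  intro O q hAt
  refine ⟨NegB.LfQ κ.K₀, le_rfl, ?_⟩
  -- K-2: the raised kit index `mkP := RK 0 + D` and its clearance `RK 0 + D ≤ RK mkP`
  have hRK : NegB.KS.RK t O.merged 0 + D ≤ NegB.KS.RK t O.merged (NegB.KS.RK t O.merged 0 + D) :=
    NegB.RK_add_le_RK_raise_of_atQ 0 (NegB.atQ3_of_atQ3VPx hAt)
  -- the cells of the tuple at `O.merged` ARE `cR2W mkP` / `hFR mkP` (definitionally); `AtQNQ` does not read cells
  have hAt' : (NegB.choiceAtQ3V κ Φ t p Pv gv fv (NegB.SUS ex mx) (NegB.cR2W (NegB.KS.RK t O.merged 0 + D)) (NegB.hFR (NegB.KS.RK t O.merged 0 + D))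
      NegB.BSlot.small3 hC).AtQNQ O q := NegB.atQ3V_cells (NegB.atQ3V_of_atQ3VPx hAt)
  -- the cells of the tuple read at `O.merged` ARE `cR2W mkP` / `hFR mkP` (one `rfl` each through «SlotsPx».cvPx_at/hvPx_at — no structure unfolding)
  have hc : NegB.cOf κ Φ t p O gv fv (NegB.cvPx D) = NegB.cOf κ Φ t p O gv fv (NegB.cR2W (NegB.KS.RK t O.merged 0 + D)) := by
    funext i; exact NegB.cvPx_at κ Φ t p O.merged D _ _ i
  have hh : NegB.hOf κ Φ t p O gv fv (NegB.hvPx D) = NegB.hOf κ Φ t p O gv fv (NegB.hFR (NegB.KS.RK t O.merged 0 + D)) := by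
    funext i; exact NegB.hvPx_at κ Φ t p O.merged D _ _ i
  -- the two row bundles at the raised index (pointwise floors, long radius `RL + D`)
  obtain ⟨ρ, qq, W, HK, N, aW, Bx, bL, hρ1, hρ2, hρ3, hPl, hPt, hLl, ha, hBx, hbL, haq, hbW, hN, hLt⟩ :=
    NegB.HX_QVAtPx (hC := hC) (Pv := Pv) (fv := fv) (mx := mx) (NegB.KS.RK t O.merged 0 + D) D (five_le_Kq_of_le κ hKmin hK) O q hAt'
      (Hg κ Φ t p O.merged).1 (Hg κ Φ t p O.merged).2 (Hex κ Φ t p O.merged _ _).1 (Hex κ Φ t p O.merged _ _).2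
  obtain ⟨ρ', qq', W', HK', N', aW', Bx', bL', hρ1', hρ2', hρ3', hPR', hLl', ha', hBx', hbL', haW', haW'', hbq', hN', hLt'⟩ :=
    NegB.HY_QVAtPx (hC := hC) (Pv := Pv) (fv := fv) (mx := mx) (NegB.KS.RK t O.merged 0 + D) D (five_le_Kq_of_le κ hKmin hK) O q hAt'
      (Hg κ Φ t p O.merged).1 (Hg κ Φ t p O.merged).2 (HexY κ Φ t p O.merged _ _).1 (HexY κ Φ t p O.merged _ _).2
  rw [← hc, ← hh] at hPl hPt hLl hLt hPR' hLl' hLt'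
  exact Skel.reachOblRHNOF_of_axes
    (fun h e hrun hcO hV hdu hne => NegB.reachOblAtHNF_frmQ3VR_fstPxK hAt hP hp0 hp1 0 O.merged (NegB.KS.RK t O.merged 0 + D) hRK hrun hcO hV hdu hne HK N hρ1 hρ2 hρ3
      hPl hPt hLl (hLt (tgt e)) ha hBx hbL haq hbW hN)
    (fun h e hrun hcO hV hdu hne => NegB.reachOblAtHNF_frmQ3VR_sndUPxK hAt hP hp0 hp1 0 O.merged (NegB.KS.RK t O.merged 0 + D) hRK hrun hcO hV hdu hne HK' N' hρ1' hρ2' hρ3'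
      hPR' hLl' (hLt' (tgt e)) ha' hBx' hbL' haW' haW'' hbq' hN')

end PlanarSkeletonFrmFrom

end Summit.CriticalPhenomena.PercolationContinuityZ3.Theorems.Transplant

end
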